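import Literature.Analysis.Pluripotential.FubiniStudyMongeAmpereMass
import HarnessLib

/-!
# Monge–Ampère densities under affine changes of variable; masses of the comparison bumps

Topic `Literature/Analysis/Pluripotential`. Bookkeeping for the comparison-principle step of the proof
of `GuedjZeriahi2007_lelongNumber_eq_zero_of_regularMass_eq` (`NonPluripolarMongeAmpereMass.lean`):

* `fderiv_fderiv_affine_comp_apply` — `D²(c g(s(· - w₀)) + d)(w) = c s² D²g(s(w - w₀))` for `g ∈ C²`
  on a real normed space;
* `leviMatrix_affine_comp`, `heightDensity_self_affine_comp` — hence
  `leviMatrix (c g(s(·-w₀))+d) w = c s² leviMatrix g (s(w-w₀))` and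
  `MA(c g(s(·-w₀))+d)(w) = (c s²)ᴺ MA(g)(s(w-w₀))` on `ℂᴺ`;
* the **comparison bumps** `w ↦ γ fsPotential((w - w₀)/η) + d = γ/2·log(1 + |w - w₀|²/η²) + d`:
  `contDiff_bump`, `heightDensity_bump`, `lintegral_heightDensity_bump` (**total mass `γᴺ`**),
  `setLIntegral_heightDensity_bump_ball` (**mass of `B(w₀, Rη)` = `γᴺ ·` Fubini–Study mass of
  `B(0, R)`**) and `tendsto_setLIntegral_heightDensity_fsPotential_ball` (the latter `→ 1`);
* `lintegral_comp_smul_sub` — `∫ f(s(w - w₀)) dλ = |s|^{-2N} ∫ f dλ` on `ℂᴺ`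
  (`finrank_real_pi_complex : dim_ℝ ℂᴺ = 2N`, `Measure.map_addHaar_smul`).

Everything is PROVED; no definitions, no named facts.
-/

noncomputable section

open scoped Topology ComplexConjugate ENNReal
open MeasureTheory Filter Set Metric Complex
open Literature.AlgebraicGeometry.HodgeTheory.BiextensionHeight (leviMatrix heightDensity
  fsPotential)

namespace Literature.Analysis.Pluripotential

variable {N : ℕ}

/-! ### Second derivatives of `w ↦ c g(s(w - w₀)) + d` -/

section Affine

variable {E : Type*} [NormedAddCommGroup E] [NormedSpace ℝ E]

/-- **Chain rule for an affine reparametrisation**: for `g` of class `C²`,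
`D²(c g(s(· - w₀)) + d)(w)(a, b) = c s² D²g(s(w - w₀))(a, b)`. [folklore] -/
theorem fderiv_fderiv_affine_comp_apply {g : E → ℝ} (hg : ContDiff ℝ 2 g) (c d s : ℝ) (w₀ w : E)
    (a b : E) :
    fderiv ℝ (fderiv ℝ (fun w ↦ c * g (s • (w - w₀)) + d)) w a b
      = c * s ^ 2 * fderiv ℝ (fderiv ℝ g) (s • (w - w₀)) a b := by
  -- the affine map and its (constant) derivative
  set S : E →L[ℝ] E := s • ContinuousLinearMap.id ℝ E with hS
  have hA : ∀ w : E, HasFDerivAt (fun w : E ↦ s • (w - w₀)) S w := fun w ↦ by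
    have h : HasFDerivAt (fun w : E ↦ s • (w - w₀)) (s • ContinuousLinearMap.id ℝ E) w :=
      ((hasFDerivAt_id (𝕜 := ℝ) w).sub_const w₀).const_smul s
    simpa [hS] using h
  have hg1 : ∀ y : E, HasFDerivAt g (fderiv ℝ g y) y := fun y ↦
    (hg.differentiable (by simp) y).hasFDerivAt
  have hg2 : ∀ y : E, HasFDerivAt (fderiv ℝ g) (fderiv ℝ (fderiv ℝ g) y) y := fun y ↦
    ((hg.fderiv_right (m := 1) le_rfl).differentiable one_ne_zero y).hasFDerivAt
  -- first derivative everywhere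
  have hD1 : ∀ w : E, HasFDerivAt (fun w ↦ c * g (s • (w - w₀)) + d)
      (c • (fderiv ℝ g (s • (w - w₀))).comp S) w := by
    intro w
    have h := (((hg1 _).comp w (hA w)).const_mul c).add_const d
    simpa using h
  have hfd : fderiv ℝ (fun w ↦ c * g (s • (w - w₀)) + d)
      = fun w ↦ c • (fderiv ℝ g (s • (w - w₀))).comp S := funext fun w ↦ (hD1 w).fderiv
  rw [hfd]
  -- second derivative
  set Φ : (E →L[ℝ] ℝ) →L[ℝ] E →L[ℝ] ℝ := (ContinuousLinearMap.compL ℝ E E ℝ).flip S with hΦ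
  have hD2 : HasFDerivAt (fun w ↦ c • (fderiv ℝ g (s • (w - w₀))).comp S)
      (c • Φ.comp ((fderiv ℝ (fderiv ℝ g) (s • (w - w₀))).comp S)) w := by
    have h := (Φ.hasFDerivAt.comp w ((hg2 _).comp w (hA w))).const_smul c
    exact h.congr_of_eventuallyEq (Eventually.of_forall fun w ↦ by simp [hΦ])
  rw [hD2.fderiv]
  simp only [smul_apply, ContinuousLinearMap.coe_comp, Function.comp_apply, hΦ,
    ContinuousLinearMap.flip_apply, ContinuousLinearMap.compL_apply, hS, ContinuousLinearMap.coe_id',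
    id_eq, map_smul, smul_eq_mul]
  ring

end Affine

/-! ### Levi matrices and Monge–Ampère densities under affine changes of variable -/

/-- **`leviMatrix` under an affine reparametrisation**: for `g : ℂᴺ → ℝ` of class `C²` and real
`c, d, s`, `leviMatrix (c g(s(· - w₀)) + d) w = c s² · leviMatrix g (s(w - w₀))`. [folklore] -/
theorem leviMatrix_affine_comp {g : (Fin N → ℂ) → ℝ} (hg : ContDiff ℝ 2 g) (c d s : ℝ)
    (w₀ w : Fin N → ℂ) :
    leviMatrix (fun w ↦ c * g (s • (w - w₀)) + d) w
      = ((c * s ^ 2 : ℝ) : ℂ) • leviMatrix g (s • (w - w₀)) := by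
  ext p q
  rw [leviMatrix_apply, Matrix.smul_apply, leviMatrix_apply, smul_eq_mul]
  simp only [fderiv_fderiv_affine_comp_apply hg]
  push_cast
  ring

/-- **The Monge–Ampère density under an affine reparametrisation**:
`MA(c g(s(· - w₀)) + d)(w) = (c s²)ᴺ MA(g)(s(w - w₀))`. [folklore] -/
theorem heightDensity_self_affine_comp {g : (Fin N → ℂ) → ℝ} (hg : ContDiff ℝ 2 g) (c d s : ℝ)
    (w₀ w : Fin N → ℂ) :
    heightDensity N (fun w ↦ c * g (s • (w - w₀)) + d) w
      = (c * s ^ 2) ^ N * heightDensity N g (s • (w - w₀)) := by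
  rw [heightDensity_self_eq, heightDensity_self_eq, leviMatrix_affine_comp hg, Matrix.det_smul,
    Fintype.card_fin, ← Complex.ofReal_pow, Complex.re_ofReal_mul]
  ring

/-- The regularised comparison bump `γ · fsPotential((w - w₀)/η) + d = γ/2 · log(1 + |w-w₀|²/η²) + d`
is smooth. [folklore] -/
theorem contDiff_bump (γ d η : ℝ) (w₀ : Fin N → ℂ) {n : ℕ∞} :
    ContDiff ℝ n fun w : Fin N → ℂ ↦ γ * fsPotential (η⁻¹ • (w - w₀)) + d := by
  have hfs : ContDiff ℝ n (fsPotential : (Fin N → ℂ) → ℝ) :=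
    contDiff_fsPotential.of_le (mod_cast le_top)
  exact (contDiff_const.mul (hfs.comp ((contDiff_id.sub contDiff_const).const_smul _))).add
    contDiff_const

/-- `fsPotential` is `C²`. [folklore] -/
theorem contDiff_two_fsPotential : ContDiff ℝ 2 (fsPotential : (Fin N → ℂ) → ℝ) :=
  contDiff_infty.1 contDiff_fsPotential 2

/-- **The Monge–Ampère density of the comparison bump** `γ fsPotential((w - w₀)/η) + d` (`γ ≥ 0`,
`η > 0`): `(γ/η²)ᴺ · N!/(πᴺ (1 + |w - w₀|²/η²)^{N+1})`, through the density of `fsPotential`.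
[folklore] -/
theorem heightDensity_bump (γ d η : ℝ) (w₀ w : Fin N → ℂ) :
    heightDensity N (fun w : Fin N → ℂ ↦ γ * fsPotential (η⁻¹ • (w - w₀)) + d) w
      = (γ * η⁻¹ ^ 2) ^ N * heightDensity N fsPotential (η⁻¹ • (w - w₀)) :=
  heightDensity_self_affine_comp contDiff_two_fsPotential γ d η⁻¹ w₀ w

/-! ### Lebesgue measure on `ℂᴺ` under `w ↦ s(w - w₀)`; masses of the comparison bumps -/

/-- `dim_ℝ ℂᴺ = 2N`. [folklore] -/
theorem finrank_real_pi_complex : Module.finrank ℝ (Fin N → ℂ) = 2 * N := by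
  rw [Module.finrank_pi_fintype, Finset.sum_const, Finset.card_univ, Fintype.card_fin,
    Complex.finrank_real_complex, smul_eq_mul, mul_comm]

/-- **Change of variables `w ↦ s (w - w₀)` in `ℂᴺ`** (`s ≠ 0`):
`∫ f(s(w - w₀)) dλ(w) = |s|^{-2N} ∫ f dλ`. [folklore] -/
theorem lintegral_comp_smul_sub {f : (Fin N → ℂ) → ℝ≥0∞} (hf : Measurable f) {s : ℝ} (hs : s ≠ 0)
    (w₀ : Fin N → ℂ) :
    ∫⁻ w, f (s • (w - w₀)) = ENNReal.ofReal (|s|⁻¹ ^ (2 * N)) * ∫⁻ w, f w := by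
  have h1 : ∫⁻ w : Fin N → ℂ, f (s • (w - w₀)) = ∫⁻ w : Fin N → ℂ, f (s • w) :=
    lintegral_sub_right_eq_self (fun w : Fin N → ℂ ↦ f (s • w)) w₀
  rw [h1, ← lintegral_map hf (measurable_const_smul s), Measure.map_addHaar_smul volume hs,
    lintegral_smul_measure, finrank_real_pi_complex, abs_inv, abs_pow, inv_pow, smul_eq_mul]

/-- The Fubini–Study Monge–Ampère density is continuous. [folklore] -/
theorem continuous_heightDensity_fsPotential :
    Continuous fun w : Fin N → ℂ ↦ heightDensity N fsPotential w := by
  simp_rw [heightDensity_fsPotential]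
  exact continuous_const.div (continuous_const.mul ((continuous_const.add
    (continuous_finsetSum _ fun p _ ↦ ((continuous_apply p).norm).pow 2)).pow _))
    fun w ↦ by positivity

/-- The Fubini–Study Monge–Ampère density is measurable (as an `ℝ≥0∞`-valued function).
[folklore] -/
theorem measurable_ofReal_heightDensity_fsPotential :
    Measurable fun w : Fin N → ℂ ↦ ENNReal.ofReal (heightDensity N fsPotential w) :=
  continuous_heightDensity_fsPotential.measurable.ennreal_ofReal

/-- **Total Monge–Ampère mass of the comparison bump** `γ fsPotential((w - w₀)/η) + d`
(`γ ≥ 0`, `η ≠ 0`): `∫_{ℂᴺ} MA = γᴺ`. [folklore] -/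
theorem lintegral_heightDensity_bump {γ : ℝ} (hγ : 0 ≤ γ) (d : ℝ) {η : ℝ} (hη : η ≠ 0)
    (w₀ : Fin N → ℂ) :
    ∫⁻ w, ENNReal.ofReal
        (heightDensity N (fun w : Fin N → ℂ ↦ γ * fsPotential (η⁻¹ • (w - w₀)) + d) w)
      = ENNReal.ofReal (γ ^ N) := by
  simp_rw [heightDensity_bump]
  have hsplit : ∀ w : Fin N → ℂ,
      ENNReal.ofReal ((γ * η⁻¹ ^ 2) ^ N * heightDensity N fsPotential (η⁻¹ • (w - w₀)))
        = ENNReal.ofReal ((γ * η⁻¹ ^ 2) ^ N)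
          * ENNReal.ofReal (heightDensity N fsPotential (η⁻¹ • (w - w₀))) :=
    fun w ↦ ENNReal.ofReal_mul (by positivity)
  simp_rw [hsplit]
  rw [lintegral_const_mul' _ _ ENNReal.ofReal_ne_top,
    lintegral_comp_smul_sub measurable_ofReal_heightDensity_fsPotential (inv_ne_zero hη) w₀,
    lintegral_heightDensity_fsPotential, mul_one, ← ENNReal.ofReal_mul (by positivity)]
  congr 1
  rw [abs_inv, inv_inv, pow_mul, sq_abs, ← mul_pow]
  congr 1
  field_simp

/-- **Monge–Ampère mass of the comparison bump on the ball `B(w₀, Rη)`**: it is `γᴺ` times the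
Fubini–Study mass of `B(0, R)` (scaling `w ↦ (w - w₀)/η`). [folklore] -/
theorem setLIntegral_heightDensity_bump_ball {γ : ℝ} (hγ : 0 ≤ γ) (d : ℝ) {η : ℝ} (hη : 0 < η)
    (w₀ : Fin N → ℂ) (R : ℝ) :
    ∫⁻ w in ball w₀ (R * η), ENNReal.ofReal
        (heightDensity N (fun w : Fin N → ℂ ↦ γ * fsPotential (η⁻¹ • (w - w₀)) + d) w)
      = ENNReal.ofReal (γ ^ N)
        * ∫⁻ w in ball (0 : Fin N → ℂ) R, ENNReal.ofReal (heightDensity N fsPotential w) := by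
  simp_rw [heightDensity_bump]
  rw [← lintegral_indicator measurableSet_ball, ← lintegral_indicator measurableSet_ball]
  -- the indicator of `B(w₀, Rη)` is the indicator of `B(0, R)` after the change of variables
  set F : (Fin N → ℂ) → ℝ≥0∞ := (ball (0 : Fin N → ℂ) R).indicator
    fun y ↦ ENNReal.ofReal ((γ * η⁻¹ ^ 2) ^ N * heightDensity N fsPotential y) with hF
  have hind : (ball w₀ (R * η)).indicator (fun w : Fin N → ℂ ↦
      ENNReal.ofReal ((γ * η⁻¹ ^ 2) ^ N * heightDensity N fsPotential (η⁻¹ • (w - w₀))))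
        = fun w ↦ F (η⁻¹ • (w - w₀)) := by
    funext w
    have hmem : w ∈ ball w₀ (R * η) ↔ η⁻¹ • (w - w₀) ∈ ball (0 : Fin N → ℂ) R := by
      rw [mem_ball, dist_eq_norm, mem_ball_zero_iff, norm_smul, norm_inv, Real.norm_eq_abs,
        abs_of_pos hη, inv_mul_lt_iff₀ hη, mul_comm]
    by_cases hw : w ∈ ball w₀ (R * η)
    · rw [indicator_of_mem hw, hF, indicator_of_mem (hmem.1 hw)]
    · rw [indicator_of_notMem hw, hF, indicator_of_notMem (fun h ↦ hw (hmem.2 h))]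
  have hFm : Measurable F := by
    refine Measurable.indicator ?_ measurableSet_ball
    exact (continuous_const.mul continuous_heightDensity_fsPotential).measurable.ennreal_ofReal
  rw [hind, lintegral_comp_smul_sub hFm (inv_ne_zero hη.ne') w₀, hF]
  -- constants
  have hsplit : (ball (0 : Fin N → ℂ) R).indicator
      (fun y ↦ ENNReal.ofReal ((γ * η⁻¹ ^ 2) ^ N * heightDensity N fsPotential y))
        = fun y ↦ ENNReal.ofReal ((γ * η⁻¹ ^ 2) ^ N) * (ball (0 : Fin N → ℂ) R).indicator
          (fun y ↦ ENNReal.ofReal (heightDensity N fsPotential y)) y := by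
    funext y
    by_cases hy : y ∈ ball (0 : Fin N → ℂ) R
    · rw [indicator_of_mem hy, indicator_of_mem hy, ENNReal.ofReal_mul (by positivity)]
    · rw [indicator_of_notMem hy, indicator_of_notMem hy, mul_zero]
  rw [hsplit, lintegral_const_mul' _ _ ENNReal.ofReal_ne_top, ← mul_assoc,
    ← ENNReal.ofReal_mul (by positivity)]
  congr 2
  rw [abs_inv, inv_inv, pow_mul, sq_abs, ← mul_pow]
  congr 1
  field_simp

/-- **The Fubini–Study mass of large balls tends to the total mass `1`**:
`∫_{B(0,R)} (dd^c fsPotential)ᴺ → 1` as `R → ∞` (monotone convergence). [folklore] -/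
theorem tendsto_setLIntegral_heightDensity_fsPotential_ball :
    Tendsto (fun R : ℕ ↦ ∫⁻ w in ball (0 : Fin N → ℂ) R, ENNReal.ofReal (heightDensity N fsPotential w))
      atTop (𝓝 1) := by
  set ν : Measure (Fin N → ℂ) := volume.withDensity
    fun w ↦ ENNReal.ofReal (heightDensity N fsPotential w) with hν
  have h1 : ∀ R : ℕ, ∫⁻ w in ball (0 : Fin N → ℂ) R, ENNReal.ofReal (heightDensity N fsPotential w)
      = ν (ball 0 R) := fun R ↦ (withDensity_apply _ measurableSet_ball).symm
  simp_rw [h1]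
  have h2 : ν univ = 1 := by
    rw [hν, withDensity_apply _ MeasurableSet.univ, Measure.restrict_univ,
      lintegral_heightDensity_fsPotential]
  rw [← h2, ← iUnion_ball_nat (0 : Fin N → ℂ)]
  exact tendsto_measure_iUnion_atTop fun m n hmn ↦ ball_subset_ball (by exact_mod_cast hmn)

end Literature.Analysis.Pluripotential

end
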